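import Mathlib
import HarnessLib
import Summits.ValiantsHypothesis.ValiantsHypothesis.Theorems.LacunarySymmetroidMatrixDescartesProductPlusOneEulerSectorsTop
import Summits.ValiantsHypothesis.ValiantsHypothesis.Theorems.LacunarySymmetroidMatrixDescartesProductPlusOneLowerSigned

/-!
# ValiantsHypothesis / LacunarySymmetroid — crux `MatrixDescartes` (stmt-ValiantsHypothesis-18050, V1),
# LINE (A) «product_plus_one», S4″/S5 Euler currency: the UPPER-SIGNED SECTOR at the TOP coupling (mirror of `…LowerSigned`)

`x ↦ 1/x` companion of ✓/⧗ `eulerBound_lowerSignedK`: factors whose coefficients ABOVE THE BOTTOM LETTER are weakly one-signed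
(`a_{j,l} ≥ 0` for all `l ≥ 1`, or all `≤ 0`; the BOTTOM coefficient free, zeros allowed anywhere), TOP coupling `l₀ = K−1`, every format
`K ≥ 2`, every strictly increasing support, no further hypothesis:

* ★★ `eulerBound_upperSignedK` — `Z₊(eulerNumerator d a ⟨K−1,_⟩) ≤ 2m + 1` (✓ `card_pos_roots_euler_le_reverse` + the letter re-indexing
  `l ↦ K−1−l` of ✓ `eulerNumerator_reindex`, exactly as in ✓ `…CoherentKTop`, then `eulerBound_lowerSignedK`);
* ★ `upperSigned_sector_classK` — members `Z₊(C c·X^{m d_{K−1}} + ∏ f_j) ≤ 2m + 2`;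
* `eulerBoundK3_upperSigned` / `classRowK3_upperSigned` — the `K = 3` rows at `l₀ = 2` (`a_{j1}, a_{j2}` weakly one-signed per factor,
  `a_{j0}` free).

With `…LowerSigned` this closes, at BOTH extreme couplings and every format, the sector «no sign change strictly inside the support on the
side away from the coupled letter… » precisely: coupled at the bottom, all letters but the top weakly one-signed; coupled at the top, all
letters but the bottom weakly one-signed.  Honest framing: sector rung; `stub_classRowK3` / `stub_polyLaw` / 18050 / B OPEN; `VP ≠ VNP` NOT
proved.  No definitions, no named facts.
-/

set_option linter.dupNamespace false

namespace Summit.ValiantsHypothesis.ValiantsHypothesis.Theorems.LacunarySymmetroidMatrixDescartes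

namespace ProductPlusOne

open Polynomial Finset
open scoped BigOperators

/-! ### §F The mirror: UPPER-SIGNED factors at the TOP coupling (reversal `x ↦ 1/x`) -/

/-- ★★ **THE UPPER-SIGNED SECTOR AT THE TOP COUPLING, EVERY FORMAT** (`2 ≤ K`, `d` strictly increasing, top coupling `l₀ = K−1`, every
factor with its coefficients ABOVE THE BOTTOM LETTER weakly one-signed — bottom coefficient free, zeros allowed):
`Z₊(eulerNumerator d a ⟨K−1,_⟩) ≤ 2m + 1` (✓ `card_pos_roots_euler_le_reverse` + letter re-indexing `l ↦ K−1−l` + `eulerBound_lowerSignedK`).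
[this file's theorem] -/
theorem eulerBound_upperSignedK {m K : ℕ} (hK : 2 ≤ K) (d : Fin K → ℕ) (hd : StrictMono d) (a : Fin m → Fin K → ℝ)
    (hus : ∀ j, (∀ l : Fin K, 0 < (l : ℕ) → 0 ≤ a j l) ∨ (∀ l : Fin K, 0 < (l : ℕ) → a j l ≤ 0)) :
    ((∑ j, (∑ l, C (a j l * ((d l : ℝ) - d ⟨K - 1, by omega⟩)) * X ^ (d l)) * ∏ i ∈ Finset.univ.erase j, (∑ l, C (a i l) * X ^ (d l))
      : ℝ[X]).roots.toFinset.filter (fun t => 0 < t)).card ≤ 2 * m + 1 := by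
  classical
  set top : Fin K := ⟨K - 1, by omega⟩ with htop
  set D : ℕ := d top with hDdef
  have hD : ∀ l, d l ≤ D := fun l => hd.monotone (Fin.mk_le_mk.mpr (by have := l.isLt; omega) : l ≤ top)
  refine (card_pos_roots_euler_le_reverse d D hD a top).trans ?_
  -- re-index the letters by `Fin.rev`
  set σ : Equiv.Perm (Fin K) := Fin.revPerm with hσ
  set d' : Fin K → ℕ := fun l => D - d (σ l) with hd'
  set a' : Fin m → Fin K → ℝ := fun j l => a j (σ l) with ha'
  have hσ0 : σ ⟨0, by omega⟩ = top := by
    rw [hσ, htop]; ext; simp [Fin.revPerm_apply, Fin.rev]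
  have hσsymm : σ.symm top = ⟨0, by omega⟩ := by
    rw [Equiv.symm_apply_eq]; exact hσ0.symm
  have hre := eulerNumerator_reindex σ (fun l => D - d l) a top
  have hd'mono : StrictMono d' := by
    intro i j hij
    simp only [hd']
    have h1 : σ j < σ i := by
      rw [hσ]; simp only [Fin.revPerm_apply]; exact Fin.rev_lt_rev.mpr hij
    have h2 : d (σ j) < d (σ i) := hd h1
    have h3 : d (σ i) ≤ D := hD _
    omega
  have key := eulerBound_lowerSignedK (m := m) hK d' hd'mono a'
    (fun j => by
      rcases hus j with h | h
      · refine Or.inl fun l hl => ?_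
        simp only [ha']
        refine h (σ l) ?_
        rw [hσ]; simp only [Fin.revPerm_apply, Fin.val_rev]; omega
      · refine Or.inr fun l hl => ?_
        simp only [ha']
        refine h (σ l) ?_
        rw [hσ]; simp only [Fin.revPerm_apply, Fin.val_rev]; omega)
  -- match the shapes
  have hshape : (∑ j, (∑ l, C (a j l * (((D - d l : ℕ) : ℝ) - ((D - d top : ℕ) : ℝ))) * X ^ (D - d l))
        * ∏ i ∈ Finset.univ.erase j, (∑ l, C (a i l) * X ^ (D - d l)) : ℝ[X])
      = ∑ j, (∑ l, C (a' j l * ((d' l : ℝ) - d' ⟨0, by omega⟩)) * X ^ (d' l))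
          * ∏ i ∈ Finset.univ.erase j, (∑ l, C (a' i l) * X ^ (d' l)) := by
    rw [← hre]
    simp only [ha', hd', hσsymm]
  rw [hshape]
  exact key

/-- ★ **THE UPPER-SIGNED SECTOR AT THE TOP COUPLING, member count, EVERY FORMAT**: `Z₊(C c·X^{m d_{K−1}} + ∏ f_j) ≤ 2m + 2`.
[this file's theorem] -/
theorem upperSigned_sector_classK {m K : ℕ} (hK : 2 ≤ K) (d : Fin K → ℕ) (hd : StrictMono d) (a : Fin m → Fin K → ℝ)
    (hus : ∀ j, (∀ l : Fin K, 0 < (l : ℕ) → 0 ≤ a j l) ∨ (∀ l : Fin K, 0 < (l : ℕ) → a j l ≤ 0)) (c : ℝ) :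
    ((C c * X ^ (m * d ⟨K - 1, by omega⟩) + ∏ j, ∑ l, C (a j l) * X ^ (d l) : ℝ[X]).roots.toFinset.filter (fun t => 0 < t)).card
      ≤ 2 * m + 2 :=
  (card_pos_roots_class_le_euler d a ⟨K - 1, by omega⟩ c).trans (by have := eulerBound_upperSignedK hK d hd a hus; omega)

/-- **The `K = 3` row at the TOP coupling, Euler currency** (`d 0 < d 1 < d 2`, `a_{j1}` and `a_{j2}` weakly one-signed per factor, `a_{j0}`
free): `Z₊(eulerNumerator d a 2) ≤ 2m + 1`. [this file's theorem] -/
theorem eulerBoundK3_upperSigned {m : ℕ} (d : Fin 3 → ℕ) (h01 : d 0 < d 1) (h12 : d 1 < d 2)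
    (a : Fin m → Fin 3 → ℝ) (hus : ∀ j, (0 ≤ a j 1 ∧ 0 ≤ a j 2) ∨ (a j 1 ≤ 0 ∧ a j 2 ≤ 0)) :
    ((∑ j, (∑ l, C (a j l * ((d l : ℝ) - d 2)) * X ^ (d l)) * ∏ i ∈ Finset.univ.erase j, (∑ l, C (a i l) * X ^ (d l))
      : ℝ[X]).roots.toFinset.filter (fun t => 0 < t)).card ≤ 2 * m + 1 := by
  have hd : StrictMono d := by
    refine Fin.strictMono_iff_lt_succ.2 fun i => ?_
    fin_cases i
    · exact h01
    · exact h12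
  have hus' : ∀ j, (∀ l : Fin 3, 0 < (l : ℕ) → 0 ≤ a j l) ∨ (∀ l : Fin 3, 0 < (l : ℕ) → a j l ≤ 0) := by
    intro j
    rcases hus j with ⟨h1, h2⟩ | ⟨h1, h2⟩
    · refine Or.inl fun l hl => ?_
      fin_cases l
      · simp at hl
      · exact h1
      · exact h2
    · refine Or.inr fun l hl => ?_
      fin_cases l
      · simp at hl
      · exact h1
      · exact h2
  exact eulerBound_upperSignedK (by norm_num) d hd a hus'

/-- **The `K = 3` row at the TOP coupling, member count**: `Z₊(C c·X^{m d 2} + ∏ f_j) ≤ 2m + 2`. [this file's theorem] -/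
theorem classRowK3_upperSigned {m : ℕ} (d : Fin 3 → ℕ) (h01 : d 0 < d 1) (h12 : d 1 < d 2)
    (a : Fin m → Fin 3 → ℝ) (hus : ∀ j, (0 ≤ a j 1 ∧ 0 ≤ a j 2) ∨ (a j 1 ≤ 0 ∧ a j 2 ≤ 0)) (c : ℝ) :
    ((C c * X ^ (m * d 2) + ∏ j, ∑ l, C (a j l) * X ^ (d l) : ℝ[X]).roots.toFinset.filter (fun t => 0 < t)).card
      ≤ 2 * m + 2 :=
  (card_pos_roots_class_le_euler d a 2 c).trans (by have := eulerBoundK3_upperSigned d h01 h12 a hus; omega)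

end ProductPlusOne

end Summit.ValiantsHypothesis.ValiantsHypothesis.Theorems.LacunarySymmetroidMatrixDescartes
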